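import Summits.NavierStokesRegularity.TurbBounds.LegendreCoeffs
import HarnessLib

/-!
# Legendre coefficients of products `P_p · P_n` (triple products `Λ(n, m, p) = ∫_{-1}^1 P_n P_m P_p`) by Bonnet linearization
(cell `pub-turb` / `turb-bounds`; v2 staging — the ingredient of the tail lemma for rules with a non-constant profile `g = Σ_p ĝ_p P_p`
(`P > 0`: rows P2-R3 / P2-R4 and every RB row), rbsdp SPEC 1.1 / 3.5. Instead of the Adams–Neumann closed form of SPEC 1.1 we give
a COMPUTABLE rational recursion `tripleCoeff p n m = ĉ_m(P_p·P_n)` obtained from Bonnet's recursion, and prove it correct; any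
individual value — hence any literal coupling matrix `CE_p` — is then a `decide`/`norm_num` evaluation away.)

HONEST FRAMING: rigorous bounds for the stated PDE and boundary conditions; no claim about physical turbulence beyond the bound.
PROVED here: `legCoeff_X_mul` (`ĉ_m(X·q) = m/(2m-1)·ĉ_{m-1}(q) + (m+1)/(2m+3)·ĉ_{m+1}(q)`), `legCoeff_legendre_mul`
(`ĉ_m(P_p P_n) = tripleCoeff p n m`), `integral_legendre_triple` (`∫ P_n P_m P_p = w_m · tripleCoeff p n m`).
-/

set_option linter.style.longLine false

noncomputable section

namespace Summit.NavierStokesRegularity.TurbBounds.LegendreTriple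

open Polynomial intervalIntegral MeasureTheory Finset Literature.Analysis.SpecialFunctions
open Summit.NavierStokesRegularity.TurbBounds.LadderTail (w w_pos)
open Summit.NavierStokesRegularity.TurbBounds.LegendreCoeffs

/-- `tripleCoeff p n m = ĉ_m(P_p · P_n)`, computed by Bonnet linearization (recursion on `p`):
`P_0 P_n = P_n`; `X P_n = ((n+1)P_{n+1} + n P_{n-1})/(2n+1)`; `(p+2) P_{p+2} = (2p+3) X P_{p+1} - (p+1) P_p`. -/
def tripleCoeff : ℕ → ℕ → ℕ → ℚ
  | 0, n, m => if m = n then 1 else 0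
  | 1, n, m => (if m = n + 1 then ((n : ℚ) + 1) / (2 * n + 1) else 0) + (if m + 1 = n then (n : ℚ) / (2 * n + 1) else 0)
  | p + 2, n, m =>
      ((2 * (p : ℚ) + 3) * ((m : ℚ) / (2 * m - 1) * tripleCoeff (p + 1) n (m - 1)
          + ((m : ℚ) + 1) / (2 * m + 3) * tripleCoeff (p + 1) n (m + 1))
        - ((p : ℚ) + 1) * tripleCoeff p n m) / ((p : ℚ) + 2)

/-- `x · P_m(x) = ((m+1) P_{m+1}(x) + m P_{m-1}(x))/(2m+1)` (Bonnet; for `m = 0` the second term is absent). -/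
theorem X_mul_legendre_eval (m : ℕ) (x : ℝ) :
    x * (legendre m).eval x
      = (((m : ℝ) + 1) * (legendre (m + 1)).eval x + (m : ℝ) * (legendre (m - 1)).eval x) / (2 * (m : ℝ) + 1) := by
  rcases m with _ | k
  · simp [legendre_zero, legendre_one]
  · have h := congrArg (fun q => q.eval x) (legendre_succ_succ k)
    simp only [eval_mul, eval_C, eval_X, eval_sub] at h
    rw [show k + 1 - 1 = k from rfl]
    push_cast
    have hne : (2 * ((k : ℝ) + 1) + 1) ≠ 0 := by positivity
    field_simp
    linarith

/-- **`ĉ_m(X·q) = m/(2m-1)·ĉ_{m-1}(q) + (m+1)/(2m+3)·ĉ_{m+1}(q)`** (multiplication by `x` in the Legendre basis). -/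
theorem legCoeff_X_mul (q : ℝ[X]) (m : ℕ) :
    legCoeff (X * q) m = (m : ℝ) / (2 * m - 1) * legCoeff q (m - 1) + ((m : ℝ) + 1) / (2 * m + 3) * legCoeff q (m + 1) := by
  unfold legCoeff
  have e : ∀ x, (X * q).eval x * (legendre m).eval x
      = ((m : ℝ) + 1) / (2 * (m : ℝ) + 1) * (q.eval x * (legendre (m + 1)).eval x)
        + (m : ℝ) / (2 * (m : ℝ) + 1) * (q.eval x * (legendre (m - 1)).eval x) := by
    intro x
    rw [eval_mul, eval_X, mul_comm x, mul_assoc, X_mul_legendre_eval]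
    ring
  simp_rw [e]
  have i1 : IntervalIntegrable (fun x => ((m : ℝ) + 1) / (2 * (m : ℝ) + 1) * (q.eval x * (legendre (m + 1)).eval x)) volume (-1) 1 :=
    (Continuous.intervalIntegrable (by fun_prop) _ _)
  have i2 : IntervalIntegrable (fun x => (m : ℝ) / (2 * (m : ℝ) + 1) * (q.eval x * (legendre (m - 1)).eval x)) volume (-1) 1 :=
    (Continuous.intervalIntegrable (by fun_prop) _ _)
  rw [intervalIntegral.integral_add i1 i2, intervalIntegral.integral_const_mul, intervalIntegral.integral_const_mul]
  rcases m with _ | k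
  · simp
    ring
  · rw [show k + 1 - 1 = k from rfl]
    push_cast
    have h1 : (2 * ((k : ℝ) + 1) + 1) ≠ 0 := by positivity
    have h2 : (2 * (k : ℝ) + 1) ≠ 0 := by positivity
    have h3 : (2 * ((k : ℝ) + 1) - 1) ≠ 0 := by
      have : (2 * ((k : ℝ) + 1) - 1) = 2 * (k : ℝ) + 1 := by ring
      rw [this]; exact h2
    have h4 : (2 * ((k : ℝ) + 1 + 1) + 1) ≠ 0 := by positivity
    have h5 : (2 * ((k : ℝ) + 1) + 3) ≠ 0 := by positivity
    field_simp
    ring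

/-- **`ĉ_m(P_p · P_n) = tripleCoeff p n m`** (two-step induction on `p` via Bonnet). -/
theorem legCoeff_legendre_mul (p n m : ℕ) : legCoeff (legendre p * legendre n) m = (tripleCoeff p n m : ℝ) := by
  induction p using Nat.twoStepInduction generalizing m with
  | zero =>
    rw [legendre_zero, one_mul, legCoeff_legendre]
    simp only [tripleCoeff]
    by_cases h : n = m
    · subst h; simp
    · rw [if_neg h, if_neg (Ne.symm h)]; simp
  | one =>
    rw [legendre_one, legCoeff_X_mul, legCoeff_legendre, legCoeff_legendre]
    simp only [tripleCoeff]
    rcases m with _ | k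
    · by_cases h : n = 1
      · subst h; norm_num
      · have h' : ¬ (0 + 1 = n) := fun e => h (by omega)
        simp [h, h']
    · rw [show k + 1 - 1 = k from rfl]
      by_cases h1 : n = k
      · subst h1
        have e1 : ¬ (n = n + 1 + 1) := by omega
        have e2 : ¬ (n + 1 + 1 = n) := by omega
        simp only [if_true, e1, e2, if_false, mul_one, mul_zero, add_zero]
        push_cast
        have h3 : (2 * ((n : ℝ) + 1) - 1) = 2 * (n : ℝ) + 1 := by ring
        rw [h3]
      · by_cases h2 : n = k + 1 + 1
        · subst h2
          have e1 : ¬ (k + 1 = k + 1 + 1 + 1) := by omega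
          simp only [h1, if_false, if_true, e1, mul_zero, mul_one, zero_add]
          push_cast
          have h5 : (2 * ((k : ℝ) + 1) + 3) ≠ 0 := by positivity
          have h6 : (2 * ((k : ℝ) + 1 + 1) + 1) ≠ 0 := by positivity
          field_simp
          ring
        · have e2 : ¬ (k + 1 + 1 = n) := fun e => h2 (by omega)
          have e3 : ¬ (k = n) := fun e => h1 e.symm
          simp [h1, h2, e2, e3]
  | more p ih0 ih1 =>
    rw [legendre_add_two]
    have e : (C ((2 * (p : ℝ) + 3) / (p + 2)) * X * legendre (p + 1) - C (((p : ℝ) + 1) / (p + 2)) * legendre p) * legendre n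
        = C ((2 * (p : ℝ) + 3) / (p + 2)) * (X * (legendre (p + 1) * legendre n)) - C (((p : ℝ) + 1) / (p + 2)) * (legendre p * legendre n) := by
      ring
    rw [e, legCoeff_sub, legCoeff_C_mul, legCoeff_C_mul, legCoeff_X_mul, ih1, ih1, ih0]
    simp only [tripleCoeff]
    push_cast
    have hp : ((p : ℝ) + 2) ≠ 0 := by positivity
    field_simp

/-- **Triple products**: `∫_{-1}^1 P_p P_n P_m = w_m · tripleCoeff p n m` (rbsdp SPEC 1.1's `Λ(n, m, p)`, in computable form). -/
theorem integral_legendre_triple (p n m : ℕ) :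
    ∫ x in (-1 : ℝ)..1, (legendre p).eval x * (legendre n).eval x * (legendre m).eval x = w m * (tripleCoeff p n m : ℝ) := by
  rw [← legCoeff_legendre_mul, ← integral_mul_legendre_eq]
  refine intervalIntegral.integral_congr fun x _ => ?_
  rw [eval_mul]

/-- Sanity values (rbsdp SPEC 1.1 unit tests): `Λ(1,1,2)·(2·1+1)/2 = ĉ_1(P_2 P_1) = 2/5`, `ĉ_3(P_2 P_1) = 3/5`, `ĉ_0(P_2 P_2) = 1/5`. -/
theorem tripleCoeff_examples : tripleCoeff 2 1 1 = 2 / 5 ∧ tripleCoeff 2 1 3 = 3 / 5 ∧ tripleCoeff 2 2 0 = 1 / 5 := by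
  norm_num [tripleCoeff]

/-- Symmetry of triple products in the two 'test' indices: `w_m·T(p,n,m) = w_n·T(p,m,n)`. -/
theorem w_mul_tripleCoeff_symm (p n m : ℕ) : w m * (tripleCoeff p n m : ℝ) = w n * (tripleCoeff p m n : ℝ) := by
  rw [← integral_legendre_triple, ← integral_legendre_triple]
  refine intervalIntegral.integral_congr fun x _ => ?_
  ring

/-- `T(p,n,m) = 0` when `m > p + n` (`deg (P_p P_n) = p + n`). -/
theorem tripleCoeff_eq_zero_of_lt {p n m : ℕ} (h : p + n < m) : tripleCoeff p n m = 0 := by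
  have hdeg : (legendre p * legendre n).natDegree < m := by
    refine lt_of_le_of_lt natDegree_mul_le ?_
    rw [natDegree_legendre, natDegree_legendre]; exact h
  have h0 := legCoeff_eq_zero_of_lt (legendre p * legendre n) hdeg
  rw [legCoeff_legendre_mul] at h0
  exact_mod_cast h0

/-- `T(p,n,m) = 0` when `n > p + m` (by symmetry). -/
theorem tripleCoeff_eq_zero_of_lt' {p n m : ℕ} (h : p + m < n) : tripleCoeff p n m = 0 := by
  have h1 := w_mul_tripleCoeff_symm p n m
  rw [tripleCoeff_eq_zero_of_lt h, Rat.cast_zero, mul_zero] at h1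
  have hw : w m ≠ 0 := (w_pos m).ne'
  have : (tripleCoeff p n m : ℝ) = 0 := by
    rcases mul_eq_zero.mp h1 with h2 | h2
    · exact absurd h2 hw
    · exact h2
  exact_mod_cast this

/-- In particular the coupling of modes `n ≤ N` and `m > N + P` through a profile of degree `≤ P` vanishes (rbsdp SPEC 3.5:
'every pair with one index `≤ N` and `Λ ≠ 0` lies in `S`'). -/
theorem tripleCoeff_eq_zero_of_far {p P N n m : ℕ} (hp : p ≤ P) (hn : n ≤ N) (hm : N + P < m) : tripleCoeff p n m = 0 :=
  tripleCoeff_eq_zero_of_lt (by omega)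

/-- Symmetric companion of `tripleCoeff_eq_zero_of_far`. -/
theorem tripleCoeff_eq_zero_of_far' {p P N n m : ℕ} (hp : p ≤ P) (hm : m ≤ N) (hn : N + P < n) : tripleCoeff p n m = 0 :=
  tripleCoeff_eq_zero_of_lt' (by omega)

/-- **Table certification by recursion checks** (linear kernel cost). If a lookup table `tab p n m` satisfies the two base levels of
`tripleCoeff` on `n < M` and Bonnet's recursion step on the table itself — level `p + 2` from levels `p + 1` (columns `m ∓ 1`) and `p` —
with level `p` checked on the columns `m < M + Q − p` (one more column per level down, since the step reads column `m + 1`), then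
`tab = tripleCoeff` on that range. Used by the generated per-row tables (`decide +kernel` on each check), avoiding the `3^p`-fold
re-evaluation of the ternary recursion that a direct `decide` of `tripleCoeff p n m` would cost. -/
theorem tripleCoeff_eq_of_checks (tab : ℕ → ℕ → ℕ → ℚ) (M Q : ℕ)
    (h0 : ∀ n < M, ∀ m < M + Q - 0, tab 0 n m = if m = n then 1 else 0)
    (h1 : ∀ n < M, ∀ m < M + Q - 1,
      tab 1 n m = (if m = n + 1 then ((n : ℚ) + 1) / (2 * n + 1) else 0) + (if m + 1 = n then (n : ℚ) / (2 * n + 1) else 0))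
    (hrec : ∀ p < Q - 1, ∀ n < M, ∀ m < M + Q - (p + 2),
      tab (p + 2) n m = ((2 * (p : ℚ) + 3) * ((m : ℚ) / (2 * m - 1) * tab (p + 1) n (m - 1)
          + ((m : ℚ) + 1) / (2 * m + 3) * tab (p + 1) n (m + 1)) - ((p : ℚ) + 1) * tab p n m) / ((p : ℚ) + 2)) :
    ∀ p ≤ Q, ∀ n < M, ∀ m < M + Q - p, tripleCoeff p n m = tab p n m := by
  intro p
  induction p using Nat.twoStepInduction with
  | zero =>
    intro _ n hn m hm
    rw [h0 n hn m hm]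
    simp only [tripleCoeff]
  | one =>
    intro _ n hn m hm
    rw [h1 n hn m hm]
    simp only [tripleCoeff]
  | more p ih0 ih1 =>
    intro hp n hn m hm
    rw [hrec p (by omega) n hn m hm]
    simp only [tripleCoeff]
    rw [ih1 (by omega) n hn (m - 1) (by omega), ih1 (by omega) n hn (m + 1) (by omega), ih0 (by omega) n hn m (by omega)]

end Summit.NavierStokesRegularity.TurbBounds.LegendreTriple

end
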